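import Literature.AnabelianGeometry.EtaleTheta.SettingModelSlice2Letters
import HarnessLib

/-!
# (L3′) slice 2, file 3/13 — the open subgroup `Û_l = ĥ_l⁻¹(H₀)`, the unipotent operators `D′_t`, `b`-type elements, the torus `U^{(l)}`

Part of the (L3′) slice-2 chain (abc-iut-L6-t19; FILING SHAPE derived from scratch v5 `Slice2TheoremR2ScratchV5.lean`
551b982286441a66 by the edits E1–E4/D1–D3/H1–H2 of FILING-PLAN-SLICE2.md 9643c7e42a42ad24 and the OPTION-L re-cut of §F v1.19gz (W):
one definitions file + twelve theorem files).  Classical profinite group theory about OUR semi-synthetic `F₂hatT`; the objects and laws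
are those of the one-sentence residual of record (cf. [EtTh] §1, §2 for the role they play there — nothing of [EtTh]/[IUTchII]/[IUTchIII]
in print is asserted; no side on [IUTchIII] Cor. 3.12; MORATORIUM (E): no application to `hext_at_iff_exists_f2hatAut_of_eq`).
-/

noncomputable section

open scoped Pointwise

namespace Literature.AnabelianGeometry.EtaleTheta.SettingModel.Slice2

open Literature.AnabelianGeometry.EtaleTheta.SettingModel
open Literature.AnabelianGeometry.EtaleTheta (ZHatLevel.level ZHatLevel.levelChar)
open Literature.AnabelianGeometry.SemiGraphs (GQp)
open Literature.AnabelianGeometry.AbsoluteAnabelian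
open Literature.AnabelianGeometry.AbsoluteAnabelian.AbsTopII
open _root_.Topology

/-- **Conjugation commutes with `Ẑ`-powers**: `(g x g⁻¹)^t = g x^t g⁻¹` — a file-private copy of the landed
`SettingModel.powHat_conj` (its home is an (E)-class module that this chain does not import; R2′ of §F v1.19gz (W)(4)).
[cite: MochizukiEtTh2009, §1 p.12] -/
private theorem powHat_conj (g x : F₂hatT) (t : ZH) : powHat (g * x * g⁻¹) t = g * powHat x t * g⁻¹ := by
  let C : F₂hatT →ₜ* F₂hatT :=
    { toMonoidHom := (MulAut.conj g).toMonoidHom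
      continuous_toFun := (continuous_const.mul continuous_id).mul continuous_const }
  have hC : ∀ y, C y = g * y * g⁻¹ := fun _ => rfl
  have h := map_powHat C x t
  rw [hC, hC] at h
  exact h.symm

/-! ## §2 The open subgroup `Û_l := ĥ_l⁻¹(H₀)`, `H₀ = {(0, *, 0)}` (the `F̂₂`-closure shape of `dUU l`) -/

variable {l : ℕ+}

/-- [cite: MochizukiEtTh2009, Def 2.5 (i) p.39] -/
theorem mem_Uhat_iff (x : F₂hatT) : x ∈ Uhat l ↔ (hHat l x).x = 0 ∧ (hHat l x).z = 0 := Iff.rfl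

/-- `Û_l` is open. [cite: MochizukiEtTh2009, Def 2.5 (i) p.39] -/
theorem isOpen_Uhat : IsOpen (Uhat l : Set F₂hatT) := by
  have e : (Uhat l : Set F₂hatT) = hHat l ⁻¹' {h : Heis (ZMod l) | h.x = 0 ∧ h.z = 0} := rfl
  rw [e]
  exact (isOpen_discrete _).preimage (hHat l).continuous

/-- `Û_l` is closed. [cite: MochizukiEtTh2009, Def 2.5 (i) p.39] -/
theorem isClosed_Uhat : IsClosed (Uhat l : Set F₂hatT) := (Uhat l).isClosed_of_isOpen isOpen_Uhat

/-- `Ẑ`-powers of elements of `Û_l` stay in `Û_l` (closed subgroup). [cite: MochizukiEtTh2009, Def 2.5 (i) p.39] -/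
theorem powHat_mem_Uhat {x : F₂hatT} (hx : x ∈ Uhat l) (t : ZH) : powHat x t ∈ Uhat l := by
  have hcl : IsClosed ((powHat x) ⁻¹' (Uhat l : Set F₂hatT)) := isClosed_Uhat.preimage (powHat x).continuous
  have hsub : Set.range (iotaZ : Multiplicative ℤ → ZH) ⊆ (powHat x) ⁻¹' (Uhat l : Set F₂hatT) := by
    rintro _ ⟨k, rfl⟩
    change powHat x (iotaZ k) ∈ Uhat l
    rw [powHat_iotaZ]
    exact Subgroup.zpow_mem _ hx _
  have h := hcl.closure_subset_iff.mpr hsub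
  rw [denseRange_iotaZ.closure_range] at h
  exact h (Set.mem_univ t)

/-- `b^t ∈ Û_l`. [cite: MochizukiEtTh2009, Def 2.5 (i) p.39] -/
theorem bPow_mem_Uhat (t : ZH) : bPow t ∈ Uhat l := by
  rw [mem_Uhat_iff, hHat_bPow]; exact ⟨rfl, rfl⟩

/-- `b ∈ Û_l`. [cite: MochizukiEtTh2009, Def 2.5 (i) p.39] -/
theorem eb_mem_Uhat : eb ∈ Uhat l := by
  have h := bPow_mem_Uhat (l := l) (iotaZ (Multiplicative.ofAdd 1))
  rwa [bPow_iotaZ_one] at h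

/-- `a^s ∈ Û_l ↔ l ∣ s`. [cite: MochizukiEtTh2009, Def 2.5 (i) p.39] -/
theorem aPow_mem_Uhat_iff (s : ZH) : aPow s ∈ Uhat l ↔ ZHatLevel.level l s = 1 := by
  rw [mem_Uhat_iff, hHat_aPow]
  simp only [and_true]
  exact ⟨fun h => by rw [← ofAdd_toAdd (ZHatLevel.level l s), h]; rfl, fun h => by rw [h]; rfl⟩

/-- `β_s^t ∈ Û_l ↔ s̄·t̄ = 0 (mod l)`. [cite: MochizukiEtTh2009, Def 2.5 (i) p.39] -/
theorem betaPow_mem_Uhat_iff (s t : ZH) : betaPow s t ∈ Uhat l ↔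
    Multiplicative.toAdd (ZHatLevel.level l s) * Multiplicative.toAdd (ZHatLevel.level l t) = 0 := by
  rw [mem_Uhat_iff, hHat_betaPow]
  simp only [true_and]

/-- `β_s^t ∈ Û_l` whenever `l ∣ t`. [cite: MochizukiEtTh2009, Def 2.5 (i) p.39] -/
theorem betaPow_mem_Uhat_of_level_eq_one (s : ZH) {t : ZH} (ht : ZHatLevel.level l t = 1) :
    betaPow s t ∈ Uhat l := by
  rw [betaPow_mem_Uhat_iff, ht, toAdd_one, mul_zero]

/-- `β_s^t ∈ Û_l` whenever `l ∣ s`. [cite: MochizukiEtTh2009, Def 2.5 (i) p.39] -/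
theorem betaPow_mem_Uhat_of_level_eq_one_left {s : ZH} (hs : ZHatLevel.level l s = 1) (t : ZH) :
    betaPow s t ∈ Uhat l := by
  rw [betaPow_mem_Uhat_iff, hs, toAdd_one, zero_mul]

/-- **`Û_l` is stable under every twist `θ_φ`** (levels: `x` fixed, `z ↦ χ_l(φ) z`). [cite: MochizukiEtTh2009, Def 2.5 (i) p.39] -/
theorem twist_mem_Uhat (φ : MulAut ZH) {x : F₂hatT} (hx : x ∈ Uhat l) : twist φ x ∈ Uhat l := by
  obtain ⟨h1, h2⟩ := hx
  refine ⟨?_, ?_⟩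
  · rw [hHat_twist, Heis.diagTwist_apply]; exact h1
  · rw [hHat_twist, Heis.diagTwist_apply]
    change _ * (hHat l x).z = 0
    rw [h2, mul_zero]

/-- `θ_φ x ∈ Û_l ↔ x ∈ Û_l`. [cite: MochizukiEtTh2009, Def 2.5 (i) p.39] -/
theorem twist_mem_Uhat_iff (φ : MulAut ZH) (x : F₂hatT) : twist φ x ∈ Uhat l ↔ x ∈ Uhat l := by
  refine ⟨fun h => ?_, twist_mem_Uhat φ⟩
  have := twist_mem_Uhat φ⁻¹ h
  rwa [← twist_mul, inv_mul_cancel, twist_one] at this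

/-- `σ̂ x ∈ Û_l ↔ x ∈ Û_l`. [cite: MochizukiEtTh2009, §2 p.36] -/
theorem sigmaHat_mem_Uhat_iff (x : F₂hatT) : sigmaHat x ∈ Uhat l ↔ x ∈ Uhat l := by
  simp only [mem_Uhat_iff, hHat_sigmaHat, Heis.negXY_x, Heis.negXY_z, neg_eq_zero]

/-! ## §3 The unipotent operators `D′_t := Inn(b^t) ∘ s_{2t}` and `b`-type elements -/

/-- [cite: MochizukiEtTh2009, Prop 1.5 (iii) p.23] -/
theorem Dp_apply (t : ZH) (x : F₂hatT) : Dp t x = innB t (shear (t * t) x) := rfl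

/-- `D′_t(b^u) = b^u`. [cite: MochizukiEtTh2009, Prop 1.5 (iii) p.23] -/
theorem Dp_bPow (t u : ZH) : Dp t (bPow u) = bPow u := by
  rw [Dp_apply, shear_bPow, innB_bPow]

/-- `D′_t(a^s) = b^t · s_{2t}(a^s) · b^{-t}` with `s_{2t}(a^s) = (a b^{2t})^s`. [cite: MochizukiEtTh2009, Prop 1.5 (iii) p.23] -/
theorem Dp_aPow (t s : ZH) : Dp t (aPow s) = bPow t * powHat (ea * bPow (t * t)) s * (bPow t)⁻¹ := by
  rw [Dp_apply, innB_apply, aPow, shear_apply, map_powHat, ← shear_apply, shear_eta_of_zero]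

/-- On the Heisenberg level `l`, `D′_t` is trivial whenever `l ∣ t`. [cite: MochizukiEtTh2009, Prop 1.5 (iii) p.23] -/
theorem hHat_Dp_of_level_eq_one {t : ZH} (ht : ZHatLevel.level l t = 1) (x : F₂hatT) :
    hHat l (Dp t x) = hHat l x := by
  have h2 : ZHatLevel.level l (t * t) = 1 := by rw [map_mul, ht, mul_one]
  rw [Dp_apply, hHat_innB_of_level_eq_one l ht, hHat_shear_of_level_eq_one l h2]

/-- `D′_t x ∈ Û_l ↔ x ∈ Û_l` for `l ∣ t`. [cite: MochizukiEtTh2009, Def 2.5 (i) p.39] -/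
theorem Dp_mem_Uhat_iff {t : ZH} (ht : ZHatLevel.level l t = 1) (x : F₂hatT) : Dp t x ∈ Uhat l ↔ x ∈ Uhat l := by
  simp only [mem_Uhat_iff, hHat_Dp_of_level_eq_one ht]

/-- `θ_φ ∘ D′_t = D′_{φ t} ∘ θ_φ`. [cite: MochizukiEtTh2009, Prop 1.5 (iii) p.23] -/
theorem twist_Dp (φ : MulAut ZH) (t : ZH) (x : F₂hatT) : twist φ (Dp t x) = Dp (φ t) (twist φ x) := by
  rw [Dp_apply, Dp_apply, twist_innB, twist_shear, map_mul]

/-- `σ̂ ∘ D′_t = D′_t ∘ σ̂` — the inversion commutes with every `D′_t` (PL3-R2 S4, [I9]: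
`ι s_k ι = Inn(b^k) s_k`, so `ι D′_t ι = Inn(b^{-t}) Inn(b^{2t}) s_{2t} = D′_t`). [cite: MochizukiEtTh2009, §2 p.36] -/
theorem sigmaHat_Dp (t : ZH) (x : F₂hatT) : sigmaHat (Dp t x) = Dp t (sigmaHat x) := by
  rw [Dp_apply, Dp_apply, sigmaHat_innB, sigmaHat_shear, ← innB_mul]
  congr 1
  rw [← mul_assoc, inv_mul_cancel, one_mul]

/-- `b^u` is `b`-type. [cite: MochizukiEtTh2009, §1 p.12] -/
theorem isBType_bPow (u : ZH) : IsBType (bPow u) := ⟨1, u, by rw [one_mul, inv_one, mul_one]⟩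

/-- `β_s^u` is `b`-type. [cite: MochizukiEtTh2009, §1 p.12] -/
theorem isBType_betaPow (s u : ZH) : IsBType (betaPow s u) := ⟨aPow s, u, rfl⟩

/-- Conjugates of `b`-type elements are `b`-type. [cite: MochizukiEtTh2009, §1 p.12] -/
theorem IsBType.conj {x : F₂hatT} (hx : IsBType x) (g : F₂hatT) : IsBType (g * x * g⁻¹) := by
  obtain ⟨h, u, rfl⟩ := hx
  exact ⟨g * h, u, by rw [mul_inv_rev]; group⟩

/-- `Ẑ`-powers of `b`-type elements are `b`-type. [cite: MochizukiEtTh2009, §1 p.12] -/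
theorem IsBType.powHat {x : F₂hatT} (hx : IsBType x) (t : ZH) : IsBType (powHat x t) := by
  obtain ⟨h, u, rfl⟩ := hx
  obtain ⟨u', hu'⟩ := (mem_bAxis_iff _).1 (powHat_bPow_mem_bAxis u t)
  exact ⟨h, u', by rw [powHat_conj, hu']⟩

/-! ## §4 The torus `U‴ := U₀ ∩ χ⁻¹(1 + lẐ)` -/

section Torus

variable (p : ℕ) [Fact p.Prime]

/-- [cite: MochizukiEtTh2009, §1 p.12] -/
theorem mem_torusCong_iff (l : ℕ+) (σ : GQp p) : σ ∈ torusCong p l ↔ ZHatLevel.levelChar l (chi p σ) = 1 := Iff.rfl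

/-- `U^{(l)}` has finite index (it is the kernel of `G_{ℚ_p} → (ℤ/l)^×`). [cite: MochizukiEtTh2009, §1 p.12] -/
theorem finiteIndex_torusCong (l : ℕ+) : (torusCong p l).FiniteIndex := by
  let f : GQp p →* (ZMod l)ˣ := ((ZHatLevel.levelChar l).comp (chi p)).toHomUnits
  have hker : f.ker = torusCong p l := by
    ext σ
    rw [MonoidHom.mem_ker, mem_torusCong_iff, ← Units.val_eq_one]
    rfl
  rw [← hker]
  infer_instance

/-- For `σ ∈ U^{(l)}` and `z ∈ Ẑ`: `χ(σ) z ≡ z (mod l)`, i.e. `level l (χ(σ) z · z⁻¹) = 1`. [cite: MochizukiEtTh2009, §1 p.12] -/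
theorem level_chi_mul_inv_eq_one {l : ℕ+} {σ : GQp p} (hσ : σ ∈ torusCong p l) (z : ZH) :
    ZHatLevel.level l (chi p σ z * z⁻¹) = 1 := by
  rw [map_mul, map_inv, ← ofAdd_toAdd (ZHatLevel.level l (chi p σ z)), ZHatLevel.toAdd_level_aut,
    (mem_torusCong_iff p l σ).1 hσ, one_mul, ofAdd_toAdd, mul_inv_cancel]

end Torus

end Literature.AnabelianGeometry.EtaleTheta.SettingModel.Slice2

end
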